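import Literature.AlgebraicGeometry.Frobenioids.Cor411iiOfPreSteps
import Literature.AlgebraicGeometry.Frobenioids.Cor411iiBiratApexWeak
import Literature.AlgebraicGeometry.Frobenioids.Thm42OfPreStepsGeneralWeak
import HarnessLib

/-!
# Frobenioids I, Corollary 4.11 (ii) AS TYPED from "`Ψ`, `Ψ⁻¹` preserve pre-steps" — for WEAKLY perf-factorial
# divisor monoids (the reduction to the perfections of the isotropic parts, no hypothesis on the bases)

Mochizuki, *The geometry of Frobenioids I: the general theory*, Kyushu J. Math. **62** (2008) 293–400, Cor. 4.11 (ii)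
p. 91, proof pp. 92–94 [cite: MochizukiFrdI2008, Cor. 4.11 (ii) p.91]; "we may assume without loss of generality that
`C₁, C₂` are of isotropic type … not of group-like type" (p. 92 ll. 22–28); "passing to the perfections" (proof of
Thm. 4.2, p. 78 ll. 40–46) [cite: MochizukiFrdI2008, Thm. 4.2 (i) p.78].

PROOF-ONLY file (cell abc-iut, layer L1, node `FrdI:Cor4.11(ii)`; seat abc-iut-L1-t12, row «C411ii-WEAK» = the [FrdI]
Cor. 4.11 (ii) chain over `IsPerfFactorialWeak`, file (C)).  WEAK-HYPOTHESIS TWINS of `Cor411iiOfPreSteps.lean` (seat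
abc-iut-L1-d6) — with "`Φ_i` perf-factorial" (Def. 2.4 (i) (a)–(d)) WEAKENED to "`Φ_i` weakly perf-factorial"
(`IsPerfFactorialWeak` = (a)(b)(c) + (d_ord) + (d_res), seat abc-iut-L1-t2; cell finding F-L2d2-1: (d) fails for the
divisor monoids `Φ₀(Y^log) ⊇ ∏_J ℤ_{≥0}` of [EtTh] §3 at coverings with infinitely many special-fibre components, where
[EtTh] Cor. 3.8 (ii) quotes Cor. 4.11 (ii)):
* `FrdI.T42.exists_base_equivalence_perfection_weak` — the base square of Cor. 4.11 (ii) for `Ψ^pf : C₁^pf ⥲ C₂^pf` from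
  the PRINTED hypotheses on the `C_i` (`Thm42Setting`: standard, isotropic, not group-like; `Φ_i` weakly perf-factorial;
  `D_i` Div-slim) and ANY Frobenius-compatibility witness of `Ψ`, modulo "`(C_i)^pf` and their birationalizations are
  Frobenioids".  It REPLACES the strong chain's passage through the frozen structure `FrdI.T42.Setting` (perf-factorial
  FIELDS, `setting_perfection_asPrinted`; not twinned): the clauses of the setting at the perfections are derived
  explicitly — `C_i^pf` Frobenioids of perfect, isotropic (Prop. 3.2 (iii)), standard (Prop. 5.5 (iii)), non-group-like
  type; `Φ_i^pf` weakly perf-factorial (`IsPerfFactorialWeak.perfection`, seat abc-iut-L2-d2); Thm. 3.4 (ii) for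
  `Ψ^pf`, `(Ψ^pf)⁻¹` at perfect type over the printed FSMFF bases of standard type (d)
  (`FrdI.isPreStep_map_of_isOfPerfectType`); Thm. 3.4 (iii) (`FrdI.OfPreSteps.*`, seat abc-iut-L1-t11); Thm. 4.2 (i)
  primary pre-steps (`PreFrobenioid.isPrimaryPreStep_map_of_preSteps_weak`, seat abc-iut-f-038) — exactly the recipe
  of `Thm42OfPreStepsGeneralWeak.lean` (this seat), then `FrdI.T42.exists_base_equivalence_inst_of_clauses_weak`
  (file (B));
* `PreFrobenioid.cor411ii_of_preservesPreSteps_of_not_isOfGroupLikeType_weak` /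
  `PreFrobenioid.cor411ii_of_preservesPreSteps_weak` — the typed Cor. 4.11 (ii) from "`Ψ`, `Ψ⁻¹` preserve pre-steps
  (and group-like objects)" modulo "the perfections `(C_i^istr)^pf` and their birationalizations are Frobenioids", the
  SAME binder shape as the strong theorems (so the [EtTh] §3 dischargers `isFrobenioid_perfection_istr` /
  `isFrobenioid_birat_perfection_istr` plug in unchanged) with only the monoid hypothesis weakened: restriction to
  `C_i^istr` (Thm. 3.4 (i)), Thm. 3.4 (iii) for `Ψ^istr` (`FrdI.isFrobeniusCompatible_of_preservesPreSteps`), the base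
  square at `(C_i^istr)^pf`, descent `exists_base_equivalence_of_pf` / `cor411ii_of_istr`; printed case split
  (`FrdI.OfPreSteps.groupLike_dichotomy`): group-like type ⇒ Div-slim = slim ⇒ Thm. 3.4 (v).
The printed case (Def. 2.4 (i) (a)–(d)) is the strong file itself, equivalently these theorems at
`fun X => (hpf_i X).weak`.  No new definitions; no landed declaration touched; a named hypothesis WEAKENED, nothing of
the paper restated or strengthened; nothing here is specific to the abc programme.  HONEST FRAMING: classical [FrdI] §4;
nothing here bears on [IUTchIII] Cor. 3.12.
-/

namespace Literature.AlgebraicGeometry.Frobenioids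

/-! ## The base square at THE perfections from the printed hypotheses (weakly perf-factorial `Φ_i`) -/

namespace FrdI.T42

open CategoryTheory Opposite PreFrobenioidData PreFrobenioid.Perfection

universe w v v' u u'

variable {D₁ : Type u} [Category.{v} D₁] {Φ₁ : D₁ᵒᵖ ⥤ CommMonCat.{w}} {C₁ : Type u'} [Category.{v'} C₁]
  {D₂ : Type u} [Category.{v} D₂] {Φ₂ : D₂ᵒᵖ ⥤ CommMonCat.{w}} {C₂ : Type u'} [Category.{v'} C₂]
  {F₁ : C₁ ⥤ ElemFrobenioid Φ₁} {F₂ : C₂ ⥤ ElemFrobenioid Φ₂} (Ψ : C₁ ≌ C₂)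

set_option backward.isDefEq.respectTransparency false in
/-- **The base square of [FrdI] Cor. 4.11 (ii) for `Ψ^pf : C₁^pf ⥲ C₂^pf`, from the PRINTED hypotheses on the `C_i`
with `Φ_i` WEAKLY perf-factorial** (proof of Cor. 4.11, p. 92 ll. 22–28, p. 93 l. 30 – p. 94 l. 7; "passing to the
perfections", proof of Thm. 4.2, p. 78 ll. 40–46): for Frobenioids `C_i → F_{Φ_i}` under the typed `Thm42Setting`
(standard and isotropic type, not of group-like type), `D_i` Div-slim, `Φ_i` weakly perf-factorial, and ANY witness
`hΨ` that `Ψ` is compatible with arrows of Frobenius type (so that `Ψ^pf = Perfection.map hΨ` is defined), modulo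
"`C_i^pf` and their birationalizations are Frobenioids" (`hPf_i`, `hB_i`): an equivalence `Ψ^Base : D₁ ⥲ D₂` with
`Base₂^pf ∘ Ψ^pf ≅ Ψ^Base ∘ Base₁^pf`.  The clauses of the setting of the proof at the perfections are derived
explicitly (Prop. 3.2 (iii), Prop. 5.5 (iii), `IsPerfFactorialWeak.perfection`, Thm. 3.4 (ii)(iii) at perfect type,
Thm. 4.2 (i) primary pre-steps over `IsPerfFactorialWeak`), then `exists_base_equivalence_inst_of_clauses_weak`.
[cite: MochizukiFrdI2008, Cor. 4.11 (ii) p.91] -/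
theorem exists_base_equivalence_perfection_weak (hF₁ : PreFrobenioid.IsFrobenioid F₁)
    (hF₂ : PreFrobenioid.IsFrobenioid F₂)
    (hpf₁ : Objectwise (fun M _ => IsPerfFactorialWeak M) Φ₁)
    (hpf₂ : Objectwise (fun M _ => IsPerfFactorialWeak M) Φ₂)
    (hT : Thm42Setting (ofFunctor Φ₁ F₁) (ofFunctor Φ₂ F₂))
    (hds₁ : (ofFunctor Φ₁ F₁).IsDivSlim) (hds₂ : (ofFunctor Φ₂ F₂).IsDivSlim)
    (hΨ : PreFrobenioid.IsFrobeniusCompatible F₁ F₂ Ψ.functor)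
    (hPf₁ : PreFrobenioid.IsFrobenioid (ops hF₁).toFunctor) (hPf₂ : PreFrobenioid.IsFrobenioid (ops hF₂).toFunctor)
    (hsq₁ : PreFrobenioid.HasBiratSquares (ops hF₁).toFunctor) (hsq₂ : PreFrobenioid.HasBiratSquares (ops hF₂).toFunctor)
    (hB₁ : PreFrobenioid.IsFrobenioid (PreFrobenioid.Birat.toElemZero hPf₁ hsq₁))
    (hB₂ : PreFrobenioid.IsFrobenioid (PreFrobenioid.Birat.toElemZero hPf₂ hsq₂)) :
    ∃ ΨBase : D₁ ⥤ D₂, ΨBase.IsEquivalence ∧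
      OneCommutes (map (hF₁ := hF₁) (hF₂ := hF₂) hΨ) (ops hF₂).base (ops hF₁).base ΨBase := by
  haveI := map_isEquivalence (hF₁ := hF₁) (hF₂ := hF₂) Ψ hΨ
  obtain ⟨hi₁, hi₂, -, -, ⟨N₁, hN₁⟩, ⟨N₂, hN₂⟩⟩ := of_thm42Setting hT
  have hs₁ := hT.standard.1
  have hs₂ := hT.standard.2
  have hiso₁ := isFrobeniusIsotropic_of_isOfIsotropicType hF₁ hi₁
  have hiso₂ := isFrobeniusIsotropic_of_isOfIsotropicType hF₂ hi₂
  -- Prop. 3.2 (iii): the perfections are Frobenioids of perfect and isotropic type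
  have hperfP₁ : PreFrobenioid.IsOfPerfectType (ops hF₁).toFunctor :=
    (ofFunctor_isOfPerfectType (ops hF₁).toFunctor).1 (isOfPerfectType_perfection hF₁ hiso₁)
  have hperfP₂ : PreFrobenioid.IsOfPerfectType (ops hF₂).toFunctor :=
    (ofFunctor_isOfPerfectType (ops hF₂).toFunctor).1 (isOfPerfectType_perfection hF₂ hiso₂)
  have histrP₁ : PreFrobenioid.IsOfIsotropicType (ops hF₁).toFunctor := isOfIsotropicType_toFunctor hF₁ hiso₁
  have histrP₂ : PreFrobenioid.IsOfIsotropicType (ops hF₂).toFunctor := isOfIsotropicType_toFunctor hF₂ hiso₂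
  -- Prop. 5.5 (iii): of standard type
  have hng₁ : ¬ PreFrobenioid.IsOfType (PreFrobenioid.IsGroupLikeObj F₁) := fun h => hN₁ (h N₁)
  have hng₂ : ¬ PreFrobenioid.IsOfType (PreFrobenioid.IsGroupLikeObj F₂) := fun h => hN₂ (h N₂)
  have hnorm₁ : PreFrobenioid.IsOfType (PreFrobenioid.IsFrobeniusNormalized F₁) :=
    fun X => hs₁.frobeniusNormalized.obj X
  have hnorm₂ : PreFrobenioid.IsOfType (PreFrobenioid.IsFrobeniusNormalized F₂) :=
    fun X => hs₂.frobeniusNormalized.obj X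
  have hsP₁ := FrdI.Prop55Sub.prop55iii_pf_standard_of_not_groupLike hF₁ hPf₁ hng₁ hiso₁ hnorm₁ hs₁
  have hsP₂ := FrdI.Prop55Sub.prop55iii_pf_standard_of_not_groupLike hF₂ hPf₂ hng₂ hiso₂ hnorm₂ hs₂
  have hqP₁ := hsP₁.quasiIsotropic
  have hqP₂ := hsP₂.quasiIsotropic
  have hndP₁ : IsNonDilatingOn (ops hF₁).monFunctor :=
    isNonDilatingOn_of_ofFunctor (F := (ops hF₁).toFunctor) (isNonDilatingOn_ops hF₁ hs₁.nonDilating)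
  have hndP₂ : IsNonDilatingOn (ops hF₂).monFunctor :=
    isNonDilatingOn_of_ofFunctor (F := (ops hF₂).toFunctor) (isNonDilatingOn_ops hF₂ hs₂.nonDilating)
  have hNP₁ : ¬ PreFrobenioid.IsGroupLikeObj (ops hF₁).toFunctor ((toPf hF₁).obj N₁) :=
    fun h => hN₁ ((isGroupLikeObj_ops_iff (hF := hF₁) _).1 h)
  have hNP₂ : ¬ PreFrobenioid.IsGroupLikeObj (ops hF₂).toFunctor ((toPf hF₂).obj N₂) :=
    fun h => hN₂ ((isGroupLikeObj_ops_iff (hF := hF₂) _).1 h)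
  -- Div-slimness w.r.t. `Φ_i^pf` (it only gets easier) — `Φ_i` divisorial (Frobenioids)
  have hdsP₁ : (ops hF₁).IsDivSlim := ops_isDivSlim_of hF₁ hF₁.isPreFrobenioid.isDivisorial hds₁
  have hdsP₂ : (ops hF₂).IsDivSlim := ops_isDivSlim_of hF₂ hF₂.isPreFrobenioid.isDivisorial hds₂
  -- Def. 2.4 (i), p. 48: `Φ_i^pf` weakly perf-factorial
  have hpfP₁ : Objectwise (fun M _ => IsPerfFactorialWeak M) (ops hF₁).monFunctor :=
    fun X => (hpf₁ X).perfection
  have hpfP₂ : Objectwise (fun M _ => IsPerfFactorialWeak M) (ops hF₂).monFunctor :=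
    fun X => (hpf₂ X).perfection
  -- Thm. 3.4 (ii) for `Ψ^pf` and its quasi-inverse (perfect type, printed FSMFF bases of standard type (d))
  have hpreP : ∀ ⦃X Y : PreFrobenioid.Perfection hF₁⦄ ⦃f : X ⟶ Y⦄,
      PreFrobenioid.IsPreStep (ops hF₁).toFunctor f →
        PreFrobenioid.IsPreStep (ops hF₂).toFunctor
          ((map (hF₁ := hF₁) (hF₂ := hF₂) hΨ).asEquivalence.functor.map f) :=
    fun _ _ _ hf => FrdI.isPreStep_map_of_isOfPerfectType hPf₁ hPf₂ histrP₁ histrP₂ hperfP₁ hsP₂.fsmff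
      (map (hF₁ := hF₁) (hF₂ := hF₂) hΨ).asEquivalence hf
  have hpreP' : ∀ ⦃X Y : PreFrobenioid.Perfection hF₂⦄ ⦃f : X ⟶ Y⦄,
      PreFrobenioid.IsPreStep (ops hF₂).toFunctor f →
        PreFrobenioid.IsPreStep (ops hF₁).toFunctor
          ((map (hF₁ := hF₁) (hF₂ := hF₂) hΨ).asEquivalence.inverse.map f) :=
    fun _ _ _ hf => FrdI.isPreStep_map_of_isOfPerfectType hPf₂ hPf₁ histrP₂ histrP₁ hperfP₂ hsP₁.fsmff
      (map (hF₁ := hF₁) (hF₂ := hF₂) hΨ).asEquivalence.symm hf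
  have hstepP : ∀ ⦃X Y : PreFrobenioid.Perfection hF₁⦄ (f : X ⟶ Y),
      PreFrobenioid.IsStep (ops hF₁).toFunctor f →
        PreFrobenioid.IsStep (ops hF₂).toFunctor
          ((map (hF₁ := hF₁) (hF₂ := hF₂) hΨ).asEquivalence.functor.map f) :=
    fun _ _ _ hf => FrdI.OfPreSteps.isStep_map (map (hF₁ := hF₁) (hF₂ := hF₂) hΨ).asEquivalence hpreP hf
  have hstepP' : ∀ ⦃X Y : PreFrobenioid.Perfection hF₂⦄ (f : X ⟶ Y),
      PreFrobenioid.IsStep (ops hF₂).toFunctor f →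
        PreFrobenioid.IsStep (ops hF₁).toFunctor
          ((map (hF₁ := hF₁) (hF₂ := hF₂) hΨ).asEquivalence.inverse.map f) :=
    fun _ _ _ hf => FrdI.OfPreSteps.isStep_map (map (hF₁ := hF₁) (hF₂ := hF₂) hΨ).asEquivalence.symm hpreP' hf
  -- Thm. 3.4 (iii) for `Ψ^pf` and `(Ψ^pf)⁻¹`: arrows of Frobenius type, Frobenius degrees, pull-back morphisms
  have hfrobP : ∀ ⦃X Y : PreFrobenioid.Perfection hF₁⦄ (f : X ⟶ Y),
      PreFrobenioid.IsFrobeniusType (ops hF₁).toFunctor f →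
        PreFrobenioid.IsFrobeniusType (ops hF₂).toFunctor
          ((map (hF₁ := hF₁) (hF₂ := hF₂) hΨ).asEquivalence.functor.map f) := fun _ _ _ hf =>
    FrdI.OfPreSteps.isFrobeniusType_map_quasiIsotropic hPf₁ hPf₂ hqP₁ hqP₂ hndP₁ hndP₂
      (map (hF₁ := hF₁) (hF₂ := hF₂) hΨ).asEquivalence hpreP hpreP' hNP₁ hNP₂ hf
  have hfrobP' : ∀ ⦃X Y : PreFrobenioid.Perfection hF₂⦄ (f : X ⟶ Y),
      PreFrobenioid.IsFrobeniusType (ops hF₂).toFunctor f →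
        PreFrobenioid.IsFrobeniusType (ops hF₁).toFunctor
          ((map (hF₁ := hF₁) (hF₂ := hF₂) hΨ).asEquivalence.inverse.map f) := fun _ _ _ hf =>
    FrdI.OfPreSteps.isFrobeniusType_map_quasiIsotropic hPf₂ hPf₁ hqP₂ hqP₁ hndP₂ hndP₁
      (map (hF₁ := hF₁) (hF₂ := hF₂) hΨ).asEquivalence.symm hpreP' hpreP hNP₂ hNP₁ hf
  have hdegP : ∀ ⦃X Y : PreFrobenioid.Perfection hF₁⦄ (f : X ⟶ Y),
      PreFrobenioid.degFr (ops hF₂).toFunctor ((map (hF₁ := hF₁) (hF₂ := hF₂) hΨ).asEquivalence.functor.map f) =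
        PreFrobenioid.degFr (ops hF₁).toFunctor f := fun _ _ f =>
    FrdI.OfPreSteps.degFr_map hPf₁ hPf₂ hqP₁ hqP₂ hndP₁ hndP₂
      (map (hF₁ := hF₁) (hF₂ := hF₂) hΨ).asEquivalence hpreP hpreP' hNP₁ hNP₂ f
  have hpbP : ∀ ⦃X Y : PreFrobenioid.Perfection hF₁⦄ (f : X ⟶ Y),
      PreFrobenioid.IsPullbackMorphism (ops hF₁).toFunctor f →
        PreFrobenioid.IsPullbackMorphism (ops hF₂).toFunctor
          ((map (hF₁ := hF₁) (hF₂ := hF₂) hΨ).asEquivalence.functor.map f) := fun _ _ _ hf =>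
    FrdI.OfPreSteps.isPullbackMorphism_map_quasiIsotropic hPf₁ hPf₂ hqP₁ hqP₂ hndP₁ hndP₂
      (map (hF₁ := hF₁) (hF₂ := hF₂) hΨ).asEquivalence hpreP hpreP' hNP₁ hNP₂ hf
  have hpbP' : ∀ ⦃X Y : PreFrobenioid.Perfection hF₂⦄ (f : X ⟶ Y),
      PreFrobenioid.IsPullbackMorphism (ops hF₂).toFunctor f →
        PreFrobenioid.IsPullbackMorphism (ops hF₁).toFunctor
          ((map (hF₁ := hF₁) (hF₂ := hF₂) hΨ).asEquivalence.inverse.map f) := fun _ _ _ hf =>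
    FrdI.OfPreSteps.isPullbackMorphism_map_quasiIsotropic hPf₂ hPf₁ hqP₂ hqP₁ hndP₂ hndP₁
      (map (hF₁ := hF₁) (hF₂ := hF₂) hΨ).asEquivalence.symm hpreP' hpreP hNP₂ hNP₁ hf
  -- Thm. 4.2 (i), primary pre-steps, for `Ψ^pf` and `(Ψ^pf)⁻¹` (over `IsPerfFactorialWeak`)
  have hprimP : ∀ ⦃X Y : PreFrobenioid.Perfection hF₁⦄ (f : X ⟶ Y),
      PreFrobenioid.IsPrimaryPreStep (ops hF₁).toFunctor f →
        PreFrobenioid.IsPrimaryPreStep (ops hF₂).toFunctor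
          ((map (hF₁ := hF₁) (hF₂ := hF₂) hΨ).asEquivalence.functor.map f) :=
    fun _ _ _ h => PreFrobenioid.isPrimaryPreStep_map_of_preSteps_weak
      (map (hF₁ := hF₁) (hF₂ := hF₂) hΨ).asEquivalence hPf₁ hPf₂ hperfP₁ hperfP₂ histrP₁ histrP₂ hpfP₁ hpfP₂
      hstepP (fun _ _ f hf => hpreP hf) (fun _ _ f hf => hpreP' hf) h
  have hprimP' : ∀ ⦃X Y : PreFrobenioid.Perfection hF₂⦄ (f : X ⟶ Y),
      PreFrobenioid.IsPrimaryPreStep (ops hF₂).toFunctor f →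
        PreFrobenioid.IsPrimaryPreStep (ops hF₁).toFunctor
          ((map (hF₁ := hF₁) (hF₂ := hF₂) hΨ).asEquivalence.inverse.map f) :=
    fun _ _ _ h => PreFrobenioid.isPrimaryPreStep_inverse_map_of_preSteps_weak
      (map (hF₁ := hF₁) (hF₂ := hF₂) hΨ).asEquivalence hPf₁ hPf₂ hperfP₁ hperfP₂ histrP₁ histrP₂ hpfP₁ hpfP₂
      hstepP' (fun _ _ f hf => hpreP hf) (fun _ _ f hf => hpreP' hf) h
  -- the base square at the perfections, over the clauses (file (B))
  exact exists_base_equivalence_inst_of_clauses_weak (Ψ := (map (hF₁ := hF₁) (hF₂ := hF₂) hΨ).asEquivalence)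
    hPf₁ hPf₂ hperfP₁ hperfP₂ histrP₁ histrP₂ hpfP₁ hpfP₂ (fun _ _ f hf => hpreP hf) (fun _ _ f hf => hpreP' hf)
    hfrobP hfrobP' hdegP hpbP hpbP' hsq₁ hsq₂ hB₁ hB₂ hs₁.fsmff hs₂.fsmff hndP₁ hndP₂ hdsP₁ hdsP₂ hprimP hprimP'

end FrdI.T42

/-! ## Corollary 4.11 (ii) from "`Ψ`, `Ψ⁻¹` preserve pre-steps", weakly perf-factorial `Φ_i` -/

namespace PreFrobenioid

open CategoryTheory Opposite

universe w v v' u u'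

section Two

variable {D₁ : Type u} [Category.{v} D₁] {Φ₁ : D₁ᵒᵖ ⥤ CommMonCat.{w}}
  {C₁ : Type u'} [Category.{v'} C₁] {F₁ : C₁ ⥤ ElemFrobenioid Φ₁}
  {D₂ : Type u} [Category.{v} D₂] {Φ₂ : D₂ᵒᵖ ⥤ CommMonCat.{w}}
  {C₂ : Type u'} [Category.{v'} C₂] {F₂ : C₂ ⥤ ElemFrobenioid Φ₂}

set_option backward.isDefEq.respectTransparency false in
/-- **[FrdI] Cor. 4.11 (ii) AS TYPED, NOT of group-like type, from "`Ψ`, `Ψ⁻¹` preserve pre-steps", for WEAKLY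
perf-factorial `Φ_i`**, modulo "the perfections `(C_i^istr)^pf` and their birationalizations are Frobenioids" (`hPf_i`,
`hB_i` — same binder shape as the strong theorem): the non-group-like case of the proof of Cor. 4.11 (ii) — restriction
to `C_i^istr` (Thm. 3.4 (i)), Thm. 3.4 (iii) for `Ψ^istr` (`FrdI.isFrobeniusCompatible_of_preservesPreSteps`), the
base square at `(C_i^istr)^pf` (`FrdI.T42.exists_base_equivalence_perfection_weak`), descent along
`C_i → C_i^istr → (C_i^istr)^pf` (`exists_base_equivalence_of_pf`, `cor411ii_of_istr`).  Weak twin of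
`cor411ii_of_preservesPreSteps_of_not_isOfGroupLikeType`. [cite: MochizukiFrdI2008, Cor. 4.11 (ii) p.91] -/
theorem cor411ii_of_preservesPreSteps_of_not_isOfGroupLikeType_weak (hF₁ : IsFrobenioid F₁) (hF₂ : IsFrobenioid F₂)
    (Ψ : C₁ ≌ C₂)
    (hpf₁ : Objectwise (fun M _ => IsPerfFactorialWeak M) Φ₁)
    (hpf₂ : Objectwise (fun M _ => IsPerfFactorialWeak M) Φ₂)
    (h₁₂ : PreFrobenioidData.PreservesMor Ψ.functor (PreFrobenioidData.ofFunctor Φ₁ F₁).IsPreStep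
      (PreFrobenioidData.ofFunctor Φ₂ F₂).IsPreStep)
    (h₂₁ : PreFrobenioidData.PreservesMor Ψ.inverse (PreFrobenioidData.ofFunctor Φ₂ F₂).IsPreStep
      (PreFrobenioidData.ofFunctor Φ₁ F₁).IsPreStep)
    (hG₁ : ¬ (PreFrobenioidData.ofFunctor Φ₁ F₁).IsOfGroupLikeType)
    (hG₂ : ¬ (PreFrobenioidData.ofFunctor Φ₂ F₂).IsOfGroupLikeType)
    (hPf₁ : IsFrobenioid (Perfection.ops (isFrobenioid_istr hF₁)).toFunctor)
    (hPf₂ : IsFrobenioid (Perfection.ops (isFrobenioid_istr hF₂)).toFunctor)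
    (hB₁ : IsFrobenioid (Birat.toElemZero hPf₁ (hasBiratSquares_of_isFrobenioid hPf₁)))
    (hB₂ : IsFrobenioid (Birat.toElemZero hPf₂ (hasBiratSquares_of_isFrobenioid hPf₂))) :
    (PreFrobenioidData.ofFunctor Φ₁ F₁).Cor411ii (PreFrobenioidData.ofFunctor Φ₂ F₂) Ψ := by
  classical
  intro hs
  have hq₁ := hs.standard.1.quasiIsotropic
  have hq₂ := hs.standard.2.quasiIsotropic
  obtain ⟨N₁, hN₁⟩ : ∃ A : C₁, ¬ IsGroupLikeObj F₁ A := by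
    by_contra h
    exact hG₁ ⟨fun A => (PreFrobenioidData.ofFunctor_isGroupLikeObj F₁ A).2 (not_exists_not.mp h A)⟩
  obtain ⟨N₂, hN₂⟩ : ∃ A : C₂, ¬ IsGroupLikeObj F₂ A := by
    by_contra h
    exact hG₂ ⟨fun A => (PreFrobenioidData.ofFunctor_isGroupLikeObj F₂ A).2 (not_exists_not.mp h A)⟩
  -- the isotropic parts `C_i^istr` (Frobenioids of isotropic, standard, non-group-like type; same `Φ_i`, `D_i`)
  haveI : (isotropicObjects F₂).IsClosedUnderIsomorphisms :=
    ⟨fun e h => IsIsotropic.of_iso hF₂.isPreFrobenioid e.symm h⟩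
  let Ψi := Ψ.congrFullSubcategory (FrdI.isotropicObjects_inverseImage hF₁ hq₁ hq₂ Ψ)
  have hI₁ := isFrobenioid_istr hF₁
  have hI₂ := isFrobenioid_istr hF₂
  have hiI₁ : (PreFrobenioidData.ofFunctor Φ₁ (istrFunctor F₁)).IsOfIsotropicType :=
    (PreFrobenioidData.ofFunctor_isOfIsotropicType _).mpr isOfIsotropicType_istr
  have hiI₂ : (PreFrobenioidData.ofFunctor Φ₂ (istrFunctor F₂)).IsOfIsotropicType :=
    (PreFrobenioidData.ofFunctor_isOfIsotropicType _).mpr isOfIsotropicType_istr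
  have hqI₁ : (PreFrobenioidData.ofFunctor Φ₁ (istrFunctor F₁)).IsOfQuasiIsotropicType :=
    isOfQuasiIsotropicType_of_isOfIsotropicType Φ₁ (istrFunctor F₁) hI₁ hiI₁
  have hqI₂ : (PreFrobenioidData.ofFunctor Φ₂ (istrFunctor F₂)).IsOfQuasiIsotropicType :=
    isOfQuasiIsotropicType_of_isOfIsotropicType Φ₂ (istrFunctor F₂) hI₂ hiI₂
  have hndI₁ : (PreFrobenioidData.ofFunctor Φ₁ (istrFunctor F₁)).IsNonDilatingOn :=
    ⟨hs.standard.1.nonDilating.nonDilating⟩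
  have hndI₂ : (PreFrobenioidData.ofFunctor Φ₂ (istrFunctor F₂)).IsNonDilatingOn :=
    ⟨hs.standard.2.nonDilating.nonDilating⟩
  have hSI₁ := isOfStandardType_istr hF₁ hs.standard.1
  have hSI₂ := isOfStandardType_istr hF₂ hs.standard.2
  have hGI₁ : ¬ (PreFrobenioidData.ofFunctor Φ₁ (istrFunctor F₁)).IsOfGroupLikeType := fun h =>
    hG₁ (isOfGroupLikeType_of_istr' hF₁ h)
  have hGI₂ : ¬ (PreFrobenioidData.ofFunctor Φ₂ (istrFunctor F₂)).IsOfGroupLikeType := fun h =>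
    hG₂ (isOfGroupLikeType_of_istr' hF₂ h)
  have hT : PreFrobenioidData.Thm42Setting (PreFrobenioidData.ofFunctor Φ₁ (istrFunctor F₁))
      (PreFrobenioidData.ofFunctor Φ₂ (istrFunctor F₂)) := ⟨⟨hSI₁, hSI₂⟩, ⟨hiI₁, hiI₂⟩, ⟨hGI₁, hGI₂⟩⟩
  -- Div-slimness is a property of `(D_i, Φ_i)`, the same for `C_i^istr`
  have hdsI₁ : (PreFrobenioidData.ofFunctor Φ₁ (istrFunctor F₁)).IsDivSlim := ⟨hs.divSlim.1.eq_one⟩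
  have hdsI₂ : (PreFrobenioidData.ofFunctor Φ₂ (istrFunctor F₂)).IsDivSlim := ⟨hs.divSlim.2.eq_one⟩
  -- non-group-like objects of the `C_i^istr`: the isotropic hulls of `N_i` (the hull is a base-isomorphism)
  have hNI₁ : ¬ IsGroupLikeObj (istrFunctor F₁) ((isotropification hF₁).obj N₁) := fun h =>
    hN₁ (isGroupLikeObj_of_isBaseIso (hullHom hF₁ N₁) (isIsotropicHull_hullHom hF₁ N₁).2.1.2 h)
  have hNI₂ : ¬ IsGroupLikeObj (istrFunctor F₂) ((isotropification hF₂).obj N₂) := fun h =>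
    hN₂ (isGroupLikeObj_of_isBaseIso (hullHom hF₂ N₂) (isIsotropicHull_hullHom hF₂ N₂).2.1.2 h)
  -- pre-steps of `C_i^istr` are pre-steps of `C_i` between isotropic objects: `Ψ^istr`, `(Ψ^istr)⁻¹` preserve them
  have h₁₂i : PreFrobenioidData.PreservesMor Ψi.functor (PreFrobenioidData.ofFunctor Φ₁ (istrFunctor F₁)).IsPreStep
      (PreFrobenioidData.ofFunctor Φ₂ (istrFunctor F₂)).IsPreStep := fun X Y φ hφ => h₁₂ φ.hom hφ
  have h₂₁i : PreFrobenioidData.PreservesMor Ψi.inverse (PreFrobenioidData.ofFunctor Φ₂ (istrFunctor F₂)).IsPreStep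
      (PreFrobenioidData.ofFunctor Φ₁ (istrFunctor F₁)).IsPreStep := fun X Y φ hφ => h₂₁ φ.hom hφ
  -- Thm. 3.4 (iii): `Ψ^istr` is compatible with arrows of Frobenius type
  have hΨi : IsFrobeniusCompatible (istrFunctor F₁) (istrFunctor F₂) Ψi.functor :=
    FrdI.isFrobeniusCompatible_of_preservesPreSteps hI₁ hI₂ hqI₁ hqI₂ hndI₁ hndI₂ Ψi h₁₂i h₂₁i
      ⟨_, hNI₁⟩ ⟨_, hNI₂⟩
  -- the base square at `(C_i^istr)^pf`, from the printed hypotheses on the `C_i^istr` (weakly perf-factorial `Φ_i`)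
  have hpf' := FrdI.T42.exists_base_equivalence_perfection_weak Ψi hI₁ hI₂ hpf₁ hpf₂ hT hdsI₁ hdsI₂ hΨi hPf₁ hPf₂
    (hasBiratSquares_of_isFrobenioid hPf₁) (hasBiratSquares_of_isFrobenioid hPf₂) hB₁ hB₂
  -- descend along `C_i^istr → (C_i^istr)^pf` and along `C_i → C_i^istr`
  obtain ⟨core⟩ := nonempty_isotropification_comp_iso hF₁ hF₂ hq₁ hq₂ Ψ
  exact cor411ii_of_istr hF₁ hF₂ Ψ Ψi core (exists_base_equivalence_of_pf hI₁ hI₂ Ψi hΨi hpf') hs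

/-- **[FrdI] Cor. 4.11 (ii) AS TYPED from "`Ψ`, `Ψ⁻¹` preserve pre-steps and group-like objects", for WEAKLY
perf-factorial `Φ_i`** (the conclusion of Thm. 3.4 (ii)), modulo "the perfections `(C_i^istr)^pf` and their
birationalizations are Frobenioids" — NO hypothesis on the bases: printed case split (`FrdI.OfPreSteps.groupLike_dichotomy`);
group-like type ⇒ Div-slim = slim and the slim case is Thm. 3.4 (v) from Thm. 3.4 (iii)
(`FrdI.OfPreSteps.thm34iii_ofFunctor`, `cor411ii_inst_of_isSlim_of_thm34iii` — no `Φ`-hypothesis); else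
`cor411ii_of_preservesPreSteps_of_not_isOfGroupLikeType_weak`.  Weak twin of `cor411ii_of_preservesPreSteps`.
[cite: MochizukiFrdI2008, Cor. 4.11 (ii) p.91] -/
theorem cor411ii_of_preservesPreSteps_weak (hF₁ : IsFrobenioid F₁) (hF₂ : IsFrobenioid F₂) (Ψ : C₁ ≌ C₂)
    (hpf₁ : Objectwise (fun M _ => IsPerfFactorialWeak M) Φ₁)
    (hpf₂ : Objectwise (fun M _ => IsPerfFactorialWeak M) Φ₂)
    (h₁₂ : PreFrobenioidData.PreservesMor Ψ.functor (PreFrobenioidData.ofFunctor Φ₁ F₁).IsPreStep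
      (PreFrobenioidData.ofFunctor Φ₂ F₂).IsPreStep)
    (h₂₁ : PreFrobenioidData.PreservesMor Ψ.inverse (PreFrobenioidData.ofFunctor Φ₂ F₂).IsPreStep
      (PreFrobenioidData.ofFunctor Φ₁ F₁).IsPreStep)
    (hG : PreFrobenioidData.PreservesObj Ψ.functor (PreFrobenioidData.ofFunctor Φ₁ F₁).IsGroupLikeObj
      (PreFrobenioidData.ofFunctor Φ₂ F₂).IsGroupLikeObj)
    (hG' : PreFrobenioidData.PreservesObj Ψ.inverse (PreFrobenioidData.ofFunctor Φ₂ F₂).IsGroupLikeObj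
      (PreFrobenioidData.ofFunctor Φ₁ F₁).IsGroupLikeObj)
    (hPf₁ : IsFrobenioid (Perfection.ops (isFrobenioid_istr hF₁)).toFunctor)
    (hPf₂ : IsFrobenioid (Perfection.ops (isFrobenioid_istr hF₂)).toFunctor)
    (hB₁ : IsFrobenioid (Birat.toElemZero hPf₁ (hasBiratSquares_of_isFrobenioid hPf₁)))
    (hB₂ : IsFrobenioid (Birat.toElemZero hPf₂ (hasBiratSquares_of_isFrobenioid hPf₂))) :
    (PreFrobenioidData.ofFunctor Φ₁ F₁).Cor411ii (PreFrobenioidData.ofFunctor Φ₂ F₂) Ψ := by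
  intro hs
  rcases FrdI.OfPreSteps.groupLike_dichotomy Ψ hG hG' with ⟨hg₁, hg₂⟩ | ⟨⟨N₁, hN₁⟩, ⟨N₂, hN₂⟩⟩
  · -- group-like type: "Div-slimness amounts to slimness", and the slim case is Thm. 3.4 (v)
    have hsl₁ : IsSlim D₁ := PreFrobenioidData.isSlim_of_isDivSlim_of_isOfGroupLikeType _
      (exists_base_iso_of_isFrobenioid F₁ hF₁) hg₁ hs.divSlim.1
    have hsl₂ : IsSlim D₂ := PreFrobenioidData.isSlim_of_isDivSlim_of_isOfGroupLikeType _
      (exists_base_iso_of_isFrobenioid F₂ hF₂) hg₂ hs.divSlim.2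
    exact cor411ii_inst_of_isSlim_of_thm34iii F₁ F₂ Ψ hF₁ hF₂ hsl₁ hsl₂
      (FrdI.OfPreSteps.thm34iii_ofFunctor hF₁ hF₂ Ψ h₁₂ h₂₁ hG hG')
      (FrdI.OfPreSteps.thm34iii_ofFunctor hF₂ hF₁ Ψ.symm h₂₁ h₁₂ hG' hG) hs
  · -- not of group-like type, on both sides
    have hG₁ : ¬ (PreFrobenioidData.ofFunctor Φ₁ F₁).IsOfGroupLikeType := fun h => hN₁ (h.obj N₁)
    have hG₂ : ¬ (PreFrobenioidData.ofFunctor Φ₂ F₂).IsOfGroupLikeType := fun h => hN₂ (h.obj N₂)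
    exact cor411ii_of_preservesPreSteps_of_not_isOfGroupLikeType_weak hF₁ hF₂ Ψ hpf₁ hpf₂ h₁₂ h₂₁
      hG₁ hG₂ hPf₁ hPf₂ hB₁ hB₂ hs

/-- The printed case is recovered: at `fun X => (hpf_i X).weak` the weak theorem has the strong theorem's statement
(a record that the weakening is genuine and loses nothing). [cite: MochizukiFrdI2008, Cor. 4.11 (ii) p.91] -/
example (hF₁ : IsFrobenioid F₁) (hF₂ : IsFrobenioid F₂) (Ψ : C₁ ≌ C₂)
    (hpf₁ : Objectwise (fun M _ => IsPerfFactorial M) Φ₁) (hpf₂ : Objectwise (fun M _ => IsPerfFactorial M) Φ₂)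
    (h₁₂ : PreFrobenioidData.PreservesMor Ψ.functor (PreFrobenioidData.ofFunctor Φ₁ F₁).IsPreStep
      (PreFrobenioidData.ofFunctor Φ₂ F₂).IsPreStep)
    (h₂₁ : PreFrobenioidData.PreservesMor Ψ.inverse (PreFrobenioidData.ofFunctor Φ₂ F₂).IsPreStep
      (PreFrobenioidData.ofFunctor Φ₁ F₁).IsPreStep)
    (hG₁ : ¬ (PreFrobenioidData.ofFunctor Φ₁ F₁).IsOfGroupLikeType)
    (hG₂ : ¬ (PreFrobenioidData.ofFunctor Φ₂ F₂).IsOfGroupLikeType)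
    (hPf₁ : IsFrobenioid (Perfection.ops (isFrobenioid_istr hF₁)).toFunctor)
    (hPf₂ : IsFrobenioid (Perfection.ops (isFrobenioid_istr hF₂)).toFunctor)
    (hB₁ : IsFrobenioid (Birat.toElemZero hPf₁ (hasBiratSquares_of_isFrobenioid hPf₁)))
    (hB₂ : IsFrobenioid (Birat.toElemZero hPf₂ (hasBiratSquares_of_isFrobenioid hPf₂))) :
    (PreFrobenioidData.ofFunctor Φ₁ F₁).Cor411ii (PreFrobenioidData.ofFunctor Φ₂ F₂) Ψ :=
  cor411ii_of_preservesPreSteps_of_not_isOfGroupLikeType_weak hF₁ hF₂ Ψ (fun X => (hpf₁ X).weak)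
    (fun X => (hpf₂ X).weak) h₁₂ h₂₁ hG₁ hG₂ hPf₁ hPf₂ hB₁ hB₂

end Two

end PreFrobenioid

end Literature.AlgebraicGeometry.Frobenioids
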